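import Summits.KontsevichZagierPeriods.KontsevichZagierPeriods.Theorems.RootDecompRelativeModAbsoluteRegFoldingDegOneP14
import Summits.KontsevichZagierPeriods.KontsevichZagierPeriods.Theorems.RootDecompRelativeModAbsoluteRegKernelPairLeOneP03
import Summits.KontsevichZagierPeriods.KontsevichZagierPeriods.Theorems.LogPrimitiveNL.Negative.Rigidity

/-!
# Cell `decomp-kz`, lens 3, generation 10 — the SPLIT BENEATH the one certified translation

Generation 9 spent the lens's single EQUIV: item 30572 `RegKernelPairDegOne` ⟺ `CylKernelZero`
(§19, `regKernelPairDegOne_iff_cylKernelZero`; landed as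
`Theorems/RootDecompRelativeModAbsoluteCylKernelZeroP1/P2`).  This file types the split beneath it.

## The node (log kind)

`CylKernelZero ⟹ CylKernelZeroLog` (§1, PROVED: the `e ≡ 1` specialisation — WEAKER) and

  `CylKernelZeroLog ⟸ LogStructure ∧ BoundaryRigidity ∧ RegTorusProduct ∧ OneVarPowerBounds` (GLUE, plan §5)

where
* `LogStructure` (§2) is the conclusion, verbatim, of the tree's STRUCTURE THEOREM
  `LiouvilleUnfolding.LogPrimitiveNL.AxSchanuelGerms.stub_structure` fed with its six LANDED engine stubs
  (Ax 1971 functional Schanuel + Baker, `Theorems/LiouvilleUnfoldingLogPrimitiveNLStructureMain.lean` l.293;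
  instantiated in `Theorems/LiouvilleUnfoldingLogPrimitiveNLAxSchanuelGerms.lean`): a TREE THEOREM (the farm
  snapshot does not build that module today — `remote:stale:…:unbuilt:…StructureTaylorTransport` — so it is
  carried BY STATEMENT, token-identical, and discharged by one `exact` when the chain builds);
* `BoundaryRigidity` is `LiouvilleUnfolding.LogPrimitiveNL.Negative.BoundaryRigidity` (imported BY NAME, §2):
  the realisation of INTEGRABLE pure-logarithmic cells `[{1 ≤ u ≤ Wᵢ}, hᵢ/u]`; a TREE THEOREM
  (`boundaryRigidity_of_crux` (imported) ∘ `LogPrimitiveNL_of` (crux stmt-2836, CLOSED proved, two lines));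
* `RegTorusProduct` (§3, NEW, elementary KZ-calculus, ATTACKABLE-NOW) is the multiplicativity of the
  REGULARISED logarithmic cell `P_m(d, W) = [{u between 1 and W}, ±d (u−1)^m/u]` modulo an explicit
  polynomial base term — the one move that realises exact multiplicative relations `∏ (1+κᵢ)^{fᵢ} = 1`
  at the DEGENERATE ends `κᵢ → 0`, where the pure-log split of g9 §D is not integrable;
* `OneVarPowerBounds` (§4, KNOWN: Puiseux / Łojasiewicz at an endpoint, ATTACKABLE-NOW) supplies the
  exponent `m` that makes every piece of the regularised split honest.

Why the split is the right one (g10 analysis, NODE-g10.md §B): after the fibre substitution `u = 1 + θκᵢ`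
every monomial `cᵢ θ^M/(1+θκᵢ)` IS a regularised cell `P_M(±bᵢ, 1+κᵢ)`, `bᵢ = (−1)^M cᵢ κᵢ^{−M−1}`; the split
`P_M = (polynomial band) + P_0` into a foldable band and a pure log cell is honest at every end of every
Nash cell EXCEPT where `κᵢ → 0` with `M ≥ 1` (ends `κ → −1`, `κ → +∞`, `κ → L ≠ 0` and all `M = 0`
monomials are tame).  At a degenerate end the relation lattice splits `L = L_Z ⊕ L′` (`Z` = indices with
`κᵢ → 0`); mixed relations have `L¹` coefficients (they are `ℚ`-combinations of the tame `bᵢ`) and go to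
`BoundaryRigidity` after lowering `M` to `0`; pure-`Z` relations are realised by `RegTorusProduct` after
RAISING all `Mᵢ` to a common `m` with `q_r κᵢ^{m+1} ∈ L¹` (`OneVarPowerBounds`).  The arctangent kind
(`e = 2`, `κ > 0`) needs the unit-circle version of `LogStructure` and is NOT claimed here.

Every `theorem` below is PROVED (0 sorry); the pieces are `def … : Prop` with their tags in the docstrings.
-/

/-! # `RootDecompRelativeModAbsoluteCylLogSplitP01` — part 1/25 of the mechanical ≤330-line split of `CylLogSplit.lean`
(split by the decomp-kz census seat for landing; mathematics unchanged). -/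

noncomputable section

open Set MeasureTheory Filter Topology
open scoped BigOperators
open Literature.NumberTheory.Transcendental Literature.ModelTheory.ExponentialFields

namespace Summit.KontsevichZagierPeriods.RootDecompRelativeModAbsolute.Rung30571

namespace RegularisedLogLayer

namespace CylLog

/-! ## §1 The rung `CylKernelZeroLog` (log kind) beneath `CylKernelZero` -/

/-- **`CylKernelZero`** — verbatim the §19 statement of generation 9 (the right-hand side of the certified
translation `regKernelPairDegOne_iff_cylKernelZero`, landed inline in
`Theorems/RootDecompRelativeModAbsoluteCylKernelZeroP1/P2`): ONE cylinder family
`[P × (0,1), a₀ + Σ cᵢ θ^{Mᵢ}/(1+θ^{eᵢ}κᵢ)]` with termwise-integrable monomials and a.e.-vanishing fibre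
integrals is a relation.  [tag: EQUIV to item 30572 (g9 §19, PROVED); WEAKER than the summit] -/
def CylKernelZero : Prop :=
  ∀ (P : Set (Fin 1 → ℝ)) (V : KZ.IntegralRep (1 + 1)) (a₀ : (Fin 1 → ℝ) → ℝ) (q : ℕ)
    (c κ : Fin q → (Fin 1 → ℝ) → ℝ) (M e : Fin q → ℕ),
    IsSemialgebraic ℚ P → IsSemialgebraicFunOn ℚ P a₀ → IntegrableOn a₀ P →
    (∀ i, IsSemialgebraicFunOn ℚ P (c i)) → (∀ i, IsSemialgebraicFunOn ℚ P (κ i)) →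
    (∀ i, e i = 1 ∨ e i = 2) → (∀ i, ∀ x ∈ P, -1 < κ i x) →
    (∀ i, IntegrableOn (fun z : Fin (1 + 1) → ℝ =>
      c i (Fin.init z) * (z (Fin.last 1) ^ M i / (1 + z (Fin.last 1) ^ e i * κ i (Fin.init z))))
      {z : Fin (1 + 1) → ℝ | (Fin.init z : Fin 1 → ℝ) ∈ P ∧ z (Fin.last 1) ∈ Set.Ioo 0 1}) →
    (∀ i, IntegrableOn (fun x => c i x * ∫ θ in Set.Ioo (0 : ℝ) 1, θ ^ M i / (1 + θ ^ e i * κ i x)) P) →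
    V.domain = {z : Fin (1 + 1) → ℝ | (Fin.init z : Fin 1 → ℝ) ∈ P ∧ z (Fin.last 1) ∈ Set.Ioo 0 1} →
    Set.EqOn V.integrand (fun z => a₀ (Fin.init z) +
      ∑ i, c i (Fin.init z) * (z (Fin.last 1) ^ M i / (1 + z (Fin.last 1) ^ e i * κ i (Fin.init z))))
      V.domain →
    (∀ᵐ x : (Fin 1 → ℝ), x ∈ P →
      a₀ x + ∑ i, c i x * ∫ θ in Set.Ioo (0 : ℝ) 1, θ ^ M i / (1 + θ ^ e i * κ i x) = 0) →
    KZ.of V ∈ KZ.relations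

/-- **`CylKernelZeroLog`** — the LOGARITHMIC KIND of `CylKernelZero` (every `eᵢ = 1`: kernels
`θ^{Mᵢ}/(1+θκᵢ)`, `κᵢ > −1`).  [tag: WEAKER than `CylKernelZero` (its `e ≡ 1` specialisation,
`cylKernelZeroLog_of_cylKernelZero`), hence WEAKER than the summit; UNDECIDED; ATTACKABLE-WITH-PLAN
(§5: LogStructure ∧ BoundaryRigidity ∧ RegTorusProduct ∧ OneVarPowerBounds ⟹ this)] -/
def CylKernelZeroLog : Prop :=
  ∀ (P : Set (Fin 1 → ℝ)) (V : KZ.IntegralRep (1 + 1)) (a₀ : (Fin 1 → ℝ) → ℝ) (q : ℕ)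
    (c κ : Fin q → (Fin 1 → ℝ) → ℝ) (M : Fin q → ℕ),
    IsSemialgebraic ℚ P → IsSemialgebraicFunOn ℚ P a₀ → IntegrableOn a₀ P →
    (∀ i, IsSemialgebraicFunOn ℚ P (c i)) → (∀ i, IsSemialgebraicFunOn ℚ P (κ i)) →
    (∀ i, ∀ x ∈ P, -1 < κ i x) →
    (∀ i, IntegrableOn (fun z : Fin (1 + 1) → ℝ =>
      c i (Fin.init z) * (z (Fin.last 1) ^ M i / (1 + z (Fin.last 1) * κ i (Fin.init z))))
      {z : Fin (1 + 1) → ℝ | (Fin.init z : Fin 1 → ℝ) ∈ P ∧ z (Fin.last 1) ∈ Set.Ioo 0 1}) →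
    (∀ i, IntegrableOn (fun x => c i x * ∫ θ in Set.Ioo (0 : ℝ) 1, θ ^ M i / (1 + θ * κ i x)) P) →
    V.domain = {z : Fin (1 + 1) → ℝ | (Fin.init z : Fin 1 → ℝ) ∈ P ∧ z (Fin.last 1) ∈ Set.Ioo 0 1} →
    Set.EqOn V.integrand (fun z => a₀ (Fin.init z) +
      ∑ i, c i (Fin.init z) * (z (Fin.last 1) ^ M i / (1 + z (Fin.last 1) * κ i (Fin.init z))))
      V.domain →
    (∀ᵐ x : (Fin 1 → ℝ), x ∈ P →
      a₀ x + ∑ i, c i x * ∫ θ in Set.Ioo (0 : ℝ) 1, θ ^ M i / (1 + θ * κ i x) = 0) →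
    KZ.of V ∈ KZ.relations

/-- **Edge (PROVED): `CylKernelZero ⟹ CylKernelZeroLog`** — take `e ≡ 1`. -/
theorem cylKernelZeroLog_of_cylKernelZero (hC : CylKernelZero) : CylKernelZeroLog := by
  intro P V a₀ q c κ M hP ha₀ ha₀i hc hκ hκ1 hint hL1 hdom hV hae
  have h := hC P V a₀ q c κ M (fun _ => 1) hP ha₀ ha₀i hc hκ (fun _ => Or.inl rfl) hκ1
  simp only [pow_one] at h
  exact h hint hL1 hdom hV hae

/-! ## §2 The two TREE inputs, by statement / by name -/

/-- **`LogStructure`** — the STRUCTURE THEOREM of `ℚ`-semialgebraic log-linear identities, verbatim the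
conclusion of `Summit.KontsevichZagierPeriods.LiouvilleUnfolding.LogPrimitiveNL.AxSchanuelGerms.stub_structure`
(`Theorems/LiouvilleUnfoldingLogPrimitiveNLStructureMain.lean`): if `Σ hᵢ log Wᵢ = g` on a `ℚ`-semialgebraic
`U` with `hᵢ, Wᵢ > 0, g` `ℚ`-semialgebraic, then `U` is covered up to a null set by finitely many disjoint
open `ℚ`-semialgebraic cells on each of which `g ≡ 0` and `h = Σ_r q_r f_r` with `q_r` `ℚ`-semialgebraic and
`∏ Wᵢ^{f_r i} ≡ 1` (EXACT integer relations).  [tag: TREE THEOREM — `stub_structure stub_taylorMorphism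
stub_oneVarSemialgebraic stub_rosenlichtProperty stub_abstractLogLinear stub_constBlockDescent stub_uniformCells`
has exactly this type (all six stubs landed; `Theorems/LiouvilleUnfoldingLogPrimitiveNLAxSchanuelGerms.lean`
l.45); carried by statement only because the farm snapshot does not build that module today; inputs = Ax 1971
(tree `ax_schanuel_holds`) + Baker (tree); KNOWN · DECIDED] -/
def LogStructure : Prop :=
  ∀ (n k : ℕ) (U : Set (Fin n → ℝ)) (h W : Fin k → (Fin n → ℝ) → ℝ) (g : (Fin n → ℝ) → ℝ),
    IsSemialgebraic ℚ U → (∀ i, IsSemialgebraicFunOn ℚ U (h i)) →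
    (∀ i, IsSemialgebraicFunOn ℚ U (W i)) → (∀ i, ∀ x ∈ U, 0 < W i x) →
    IsSemialgebraicFunOn ℚ U g → (∀ x ∈ U, ∑ i, h i x * Real.log (W i x) = g x) →
    ∃ (N : ℕ) (C : Fin N → Set (Fin n → ℝ)),
      (∀ c, IsSemialgebraic ℚ (C c) ∧ IsOpen (C c) ∧ C c ⊆ U) ∧
      Pairwise (Function.onFun Disjoint C) ∧ volume (U \ ⋃ c, C c) = 0 ∧
      ∀ c, (∀ x ∈ C c, g x = 0) ∧ ∃ (R : ℕ) (f : Fin R → Fin k → ℤ) (q : Fin R → (Fin n → ℝ) → ℝ),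
        (∀ r, IsSemialgebraicFunOn ℚ (C c) (q r)) ∧ (∀ r, ∀ x ∈ C c, ∏ i, W i x ^ (f r i) = 1) ∧
        (∀ i, ∀ x ∈ C c, h i x = ∑ r, q r x * (f r i : ℝ))

/-- **`BoundaryRigidity` is available BY NAME** (imported from `Theorems/LogPrimitiveNL/Negative/Rigidity.lean`)
and follows from the CLOSED crux `LogPrimitiveNL` (stmt-2836) by the imported `boundaryRigidity_of_crux`.
[tag: TREE THEOREM (`LiouvilleUnfoldingLogPrimitiveNL.LogPrimitiveNL_of`, `…AxSchanuelGerms.LogPrimitiveNL_of`);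
KNOWN · DECIDED] -/
theorem boundaryRigidity_of_logPrimitiveNL
    (h : Summit.KontsevichZagierPeriods.KontsevichZagierPeriods.Theses.LiouvilleUnfolding.LogPrimitiveNL) :
    Summit.KontsevichZagierPeriods.LiouvilleUnfolding.LogPrimitiveNL.Negative.BoundaryRigidity :=
  Summit.KontsevichZagierPeriods.LiouvilleUnfolding.LogPrimitiveNL.Negative.boundaryRigidity_of_crux h

/-! ## §3 The NEW leaf: multiplicativity of the REGULARISED logarithmic cell (`RegTorusProduct`) -/

variable {b : ℕ}

/-- The ORIENTED regularised cell over `G`: `u` strictly between `1` and `W(x)`. -/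
def regDom (G : Set (Fin b → ℝ)) (W : (Fin b → ℝ) → ℝ) : Set (Fin (b + 1) → ℝ) :=
  {z | (Fin.init z : Fin b → ℝ) ∈ G ∧
    ((1 < z (Fin.last b) ∧ z (Fin.last b) < W (Fin.init z)) ∨
      (W (Fin.init z) < z (Fin.last b) ∧ z (Fin.last b) < 1))}

/-- The orientation sign of the cell `{u between 1 and W(x)}`. -/
def regSign (W : (Fin b → ℝ) → ℝ) (x : Fin b → ℝ) : ℝ := if 1 ≤ W x then 1 else -1

/-- The regularised integrand `± d(x) (u−1)^m/u` (sign = orientation of the cell), so that the fibre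
integral over the cell is the ORIENTED integral `d(x) ∫_1^{W(x)} (u−1)^m du/u`. -/
def regIntegrand (m : ℕ) (d W : (Fin b → ℝ) → ℝ) (z : Fin (b + 1) → ℝ) : ℝ :=
  regSign W (Fin.init z) * d (Fin.init z) * ((z (Fin.last b) - 1) ^ m / z (Fin.last b))

/-- The polynomial part of `∫_1^w (u−1)^m du/u = polyLog m w + (−1)^m log w`:
`polyLog m w = Σ_{i<m} (−1)^{m−1−i} (w−1)^{i+1}/(i+1)`. -/
def polyLog (m : ℕ) (w : ℝ) : ℝ :=
  ∑ i ∈ Finset.range m, (-1 : ℝ) ^ (m - 1 - i) * (w - 1) ^ (i + 1) / (i + 1)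

/-- The base defect of multiplicativity: `ρ_m(w₁,w₂) = polyLog m (w₁w₂) − polyLog m w₁ − polyLog m w₂`
(the logarithms cancel).  A polynomial in `w₁, w₂`. -/
def rho (m : ℕ) (w₁ w₂ : ℝ) : ℝ := polyLog m (w₁ * w₂) - polyLog m w₁ - polyLog m w₂

/-- **`RegTorusProduct`** — MULTIPLICATIVITY OF THE REGULARISED LOGARITHMIC CELL modulo a polynomial base
term: for `ℚ`-semialgebraic `d, W₁, W₂` on `G` with `W₁, W₂ > 0`, and honest representations `R₁, R₂, R₁₂`
of the regularised cells `P_m(d,W₁), P_m(d,W₂), P_m(d,W₁W₂)` and `B = [G, d·ρ_m(W₁,W₂)]`,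
`[R₁₂] − [R₁] − [R₂] − [B] ∈ KZ.relations`.
Mechanism (paper, NODE-g10.md §C): split the base by the order type of `1, W₁, W₁W₂` (rule 1a); on each piece
split the cell of `R₁₂` at the graph `u = W₁` (rule 1a, graphs are null); rescale the far band `u = W₁ s`
(rule 2, the landed fibre-map move): its integrand becomes `± d (W₁ s − 1)^m/s` on the cell of `W₂`, and
`((W₁ s − 1)^m − (s − 1)^m)/s` is a POLYNOMIAL in `s` (both numerators are `(−1)^m` at `s = 0`), so the
difference with `R₂` is a polynomial band, which FOLDS onto the base by Newton–Leibniz with a polynomial —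
hence semialgebraic — primitive (rule 3; landed one-band template `foldsTo_band_of_primitive`).  Every
intermediate representation is a restriction, an image under a substitution, or a difference of honest ones,
so no integrability hypothesis beyond the four given representations is needed.
[tag: WEAKER than the summit (its formal combination has value `0` fibrewise:
`∫_1^{w} (u−1)^m du/u = polyLog m w + (−1)^m log w`, `hasDerivAt_polyLog_add_log`; kernel form of the
summit `kernel_of_summit`, landed P01); NEW (searched: corpus+galaxy, no hits for "regularised logarithmic
cell"/"(u-1)^m/u" & "period relation"); elementary; ATTACKABLE-NOW, Lean-L; KZ 2001 §1.2 rules (1)(2)(3)] -/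
def RegTorusProduct : Prop :=
  ∀ (b m : ℕ) (G : Set (Fin b → ℝ)) (d W₁ W₂ : (Fin b → ℝ) → ℝ)
    (R₁ R₂ R₁₂ : KZ.IntegralRep (b + 1)) (B : KZ.IntegralRep b),
    IsSemialgebraic ℚ G → IsSemialgebraicFunOn ℚ G d →
    IsSemialgebraicFunOn ℚ G W₁ → IsSemialgebraicFunOn ℚ G W₂ →
    (∀ x ∈ G, 0 < W₁ x) → (∀ x ∈ G, 0 < W₂ x) →
    R₁.domain = regDom G W₁ → Set.EqOn R₁.integrand (regIntegrand m d W₁) R₁.domain →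
    R₂.domain = regDom G W₂ → Set.EqOn R₂.integrand (regIntegrand m d W₂) R₂.domain →
    R₁₂.domain = regDom G (fun x => W₁ x * W₂ x) →
    Set.EqOn R₁₂.integrand (regIntegrand m d (fun x => W₁ x * W₂ x)) R₁₂.domain →
    B.domain = G → Set.EqOn B.integrand (fun x => d x * rho m (W₁ x) (W₂ x)) B.domain →
    KZ.of R₁₂ - KZ.of R₁ - KZ.of R₂ - KZ.of B ∈ KZ.relations

/-- The derivative of the polynomial part: `polyLog' m w = ((w−1)^m − (−1)^m)/w` (`w ≠ 0`; geometric sum). -/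
theorem hasDerivAt_polyLog (m : ℕ) {w : ℝ} (hw : w ≠ 0) :
    HasDerivAt (polyLog m) (((w - 1) ^ m - (-1) ^ m) / w) w := by
  -- termwise derivative
  have hterm : ∀ i ∈ Finset.range m, HasDerivAt
      (fun w : ℝ => (-1 : ℝ) ^ (m - 1 - i) * (w - 1) ^ (i + 1) / (i + 1))
      ((-1 : ℝ) ^ (m - 1 - i) * (w - 1) ^ i) w := by
    intro i _
    have h0 : HasDerivAt (fun x : ℝ => x - 1) 1 w := (hasDerivAt_id w).sub_const 1
    have h1 : HasDerivAt (fun x : ℝ => (x - 1) ^ (i + 1))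
        (((i + 1 : ℕ) : ℝ) * (w - 1) ^ (i + 1 - 1) * 1) w := h0.pow (i + 1)
    have h2 := (h1.const_mul ((-1 : ℝ) ^ (m - 1 - i))).div_const ((i : ℝ) + 1)
    refine h2.congr_deriv ?_
    have hi : ((i : ℝ) + 1) ≠ 0 := by positivity
    rw [Nat.add_sub_cancel, div_eq_iff hi]
    push_cast
    ring
  have hsum := HasDerivAt.sum hterm
  have hfun : (∑ i ∈ Finset.range m,
      fun w : ℝ => (-1 : ℝ) ^ (m - 1 - i) * (w - 1) ^ (i + 1) / (i + 1)) = polyLog m := by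
    funext w
    simp only [Finset.sum_apply, polyLog]
  rw [hfun] at hsum
  refine hsum.congr_deriv ?_
  -- geometric sum: (Σ_{i<m} (w-1)^i (-1)^{m-1-i}) · ((w-1) − (−1)) = (w-1)^m − (−1)^m
  have hgeom := Commute.geom_sum₂_mul (Commute.all (w - 1) (-1 : ℝ)) m
  have hw' : (w - 1) - (-1 : ℝ) = w := by ring
  rw [hw'] at hgeom
  rw [eq_div_iff hw, ← hgeom]
  congr 1
  exact Finset.sum_congr rfl fun i _ => by ring

/-- **The fibre identity behind `RegTorusProduct`**: `w ↦ polyLog m w + (−1)^m log w` is a primitive of the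
regularised kernel `(w−1)^m/w` on `w ≠ 0`. -/
theorem hasDerivAt_polyLog_add_log (m : ℕ) {w : ℝ} (hw : w ≠ 0) :
    HasDerivAt (fun w => polyLog m w + (-1) ^ m * Real.log w) ((w - 1) ^ m / w) w := by
  have h := (hasDerivAt_polyLog m hw).add ((Real.hasDerivAt_log hw).const_mul ((-1 : ℝ) ^ m))
  refine h.congr_deriv ?_
  rw [← div_eq_mul_inv, ← add_div, sub_add_cancel]

/-- Hence the ORIENTED fibre integral of the regularised cell: for `0 < a`, `0 < w`,
`∫_a^w (u−1)^m du/u = (polyLog m w + (−1)^m log w) − (polyLog m a + (−1)^m log a)`. -/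
theorem integral_reg_kernel (m : ℕ) {a w : ℝ} (ha : 0 < a) (hw : 0 < w) :
    ∫ u in a..w, (u - 1) ^ m / u =
      (polyLog m w + (-1) ^ m * Real.log w) - (polyLog m a + (-1) ^ m * Real.log a) := by
  have hpos : ∀ u ∈ Set.uIcc a w, 0 < u := fun u hu => by
    rcases le_total a w with h | h
    · rw [Set.uIcc_of_le h] at hu; exact ha.trans_le hu.1
    · rw [Set.uIcc_of_ge h] at hu; exact hw.trans_le hu.1
  refine intervalIntegral.integral_eq_sub_of_hasDerivAt (fun u hu => hasDerivAt_polyLog_add_log m (hpos u hu).ne') ?_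
  refine ContinuousOn.intervalIntegrable ?_
  refine ContinuousOn.div (by fun_prop) continuousOn_id fun u hu => (hpos u hu).ne'

/-- The logarithms cancel in the multiplicativity defect: for `0 < w₁, w₂`,
`∫_1^{w₁w₂} − ∫_1^{w₁} − ∫_1^{w₂}` of the regularised kernel equals `ρ_m(w₁,w₂)` (a polynomial). -/
theorem integral_reg_kernel_mul (m : ℕ) {w₁ w₂ : ℝ} (h₁ : 0 < w₁) (h₂ : 0 < w₂) :
    (∫ u in (1 : ℝ)..(w₁ * w₂), (u - 1) ^ m / u) - (∫ u in (1 : ℝ)..w₁, (u - 1) ^ m / u) -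
      (∫ u in (1 : ℝ)..w₂, (u - 1) ^ m / u) = rho m w₁ w₂ := by
  rw [integral_reg_kernel m one_pos (mul_pos h₁ h₂), integral_reg_kernel m one_pos h₁,
    integral_reg_kernel m one_pos h₂, Real.log_mul h₁.ne' h₂.ne', Real.log_one, rho]
  simp only [polyLog, sub_self, ne_eq, Nat.add_eq_zero_iff, one_ne_zero, and_false, not_false_eq_true,
    zero_pow, mul_zero, zero_div, Finset.sum_const_zero]
  ring

/-- `polyLog m 1 = 0`. -/
theorem polyLog_one (m : ℕ) : polyLog m 1 = 0 := by
  simp [polyLog]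

/-- Hence `ρ_m(w, 1) = 0 = ρ_m(1, w)` (empty cells contribute nothing). -/
theorem rho_one_right (m : ℕ) (w : ℝ) : rho m w 1 = 0 := by
  simp [rho, polyLog_one]

/-- Auxiliary step `rho_one_left`. [bookkeeping] -/
theorem rho_one_left (m : ℕ) (w : ℝ) : rho m 1 w = 0 := by
  simp [rho, polyLog_one]

/-- Sanity: `polyLog 1 w = w − 1`, `polyLog 2 w = (w−1)²/2 − (w−1)`; `ρ₁ = (w₁−1)(w₂−1)`. -/
example (w : ℝ) : polyLog 1 w = w - 1 := by
  simp [polyLog]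

example (w : ℝ) : polyLog 2 w = (w - 1) ^ 2 / 2 - (w - 1) := by
  simp [polyLog, Finset.sum_range_succ]
  ring

example (w₁ w₂ : ℝ) : rho 1 w₁ w₂ = (w₁ - 1) * (w₂ - 1) := by
  simp [rho, polyLog]
  ring

/-! ### §3b `RegTorusProduct` is WEAKER than the summit (PROVED): its formal combination has value `0` -/

/-- The primitive of the regularised kernel: `F_m(w) = polyLog m w + (−1)^m log w`. -/
def regPrim (m : ℕ) (w : ℝ) : ℝ := polyLog m w + (-1) ^ m * Real.log w

/-- Auxiliary step `regPrim_one`. [bookkeeping] -/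
theorem regPrim_one (m : ℕ) : regPrim m 1 = 0 := by
  simp [regPrim, polyLog_one]

/-- Multiplicativity defect of the primitive = `ρ` (the logarithms cancel). -/
theorem regPrim_mul (m : ℕ) {w₁ w₂ : ℝ} (h₁ : 0 < w₁) (h₂ : 0 < w₂) :
    regPrim m (w₁ * w₂) - regPrim m w₁ - regPrim m w₂ = rho m w₁ w₂ := by
  simp only [regPrim, rho, Real.log_mul h₁.ne' h₂.ne']
  ring

/-- Fibre integral of the kernel over the cell, `W ≥ 1`. -/
theorem setIntegral_reg_kernel_of_one_le (m : ℕ) {w : ℝ} (hw : 1 ≤ w) :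
    ∫ t in Ioo 1 w, (t - 1) ^ m / t = regPrim m w := by
  rw [← integral_Ioc_eq_integral_Ioo, ← intervalIntegral.integral_of_le hw,
    integral_reg_kernel m one_pos (one_pos.trans_le hw)]
  simp [regPrim, polyLog_one]

/-- Fibre integral of the kernel over the cell, `0 < W < 1` (opposite orientation). -/
theorem setIntegral_reg_kernel_of_lt_one (m : ℕ) {w : ℝ} (hw0 : 0 < w) (hw : w < 1) :
    ∫ t in Ioo w 1, (t - 1) ^ m / t = -regPrim m w := by
  rw [← integral_Ioc_eq_integral_Ioo, ← intervalIntegral.integral_of_le hw.le,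
    integral_reg_kernel m hw0 one_pos]
  simp [regPrim, polyLog_one]

end CylLog
end RegularisedLogLayer
end Summit.KontsevichZagierPeriods.RootDecompRelativeModAbsolute.Rung30571
end
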